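import Literature.Topology.FourManifolds.HCobordismIdealCircleLemma83Proofs
import Literature.Topology.FourManifolds.HCobordismIdealCircleAdjustProofs
import Literature.Topology.FourManifolds.ComplRightHandSpheresRelPiOne
import Literature.Topology.FourManifolds.ArcClosingHomotopy

/-!
# The ideal circle of Milnor's Thm. 8.1 Index 1 *with its class*: Lemma 8.3 and the
# translation to `V₂₊` under `π₁(W, V) = 0`, the circle being null-homotopic in `W`
# (Wall 1971, Geometrical connectivity I)

Topic `Literature/Topology/FourManifolds` (infrastructure for the fact seat
`provefact-Literature.Geometry.Riemannian.LawsonMichelsohn1984_surrounding`).  Everything here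
is **proved**.

Milnor, *Lectures on the h-cobordism theorem* (1965), proof of Thm. 8.1 Index 1 (PDF
pp. 55–56), needs the circle `S₁ ⊂ V₂₊` (the translate of the ideal circle `S` of Lemma 8.3)
to be isotopic to the left-hand sphere `S₂` of the auxiliary index-`2` point; with
`π₁(V₂₊) = π₁(W) = 1` any two circles are homotopic.  Under Wall's weaker hypothesis
`π₁(W, V) = 0` (*Geometrical connectivity I*, J. London Math. Soc. (2) 3 (1971), Thm. 3;
Kervaire, Comment. Math. Helv. 40 (1965)) one arranges instead that `S`, hence `S₁`, is
**null-homotopic in `W`**: the joining path of Lemma 8.3 is chosen in the complement `T` of the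
right-hand spheres *in the class of the reversed arc*, which is possible because
`π₁(W, T) = 0` (`ComplRightHandSpheresRelPiOne.lean`); the arc closing keeps the class
(`ArcClosingHomotopy.lean`); the translation along the trajectories is a homotopy in `W`
(the flow homotopy of the slab flow, `SlabFlow.continuousOn_flowToLevel`).

* `Cobordism.exists_circle_transverse_rightHandSphere_null` — Lemma 8.3 (the statement of
  `Cobordism.Milnor1965_exists_circle_transverse_rightHandSphere`, with `π₁(W, V) = 0` in place
  of "`V` connected") **plus**: the loop of `ι₁ ∘ e` is null-homotopic rel base point in `W`.
* `Cobordism.exists_idealCircle_null` — Lemma 8.3 with its two sequels (the statement of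
  `Cobordism.Milnor1965_exists_idealCircle`) **plus**: the loop of `ι ∘ e₁` (`S₁ ⊂ V₂₊`) is
  null-homotopic rel base point in `W`.

The proofs are those of `Cobordism.Milnor1965_exists_circle_transverse_rightHandSphere_of_parts`
(`HCobordismIdealCircleLemma83.lean`) and `Cobordism.Milnor1965_exists_idealCircle_of_parts`
(`HCobordismIdealCircle.lean`) verbatim, with the joining path, the arc closing and the class
bookkeeping changed as described.

## References

* J. Milnor, *Lectures on the h-cobordism theorem*, Princeton (1965), Lemma 8.3 and proof of
  Thm. 8.1 Index 1 (PDF pp. 55–56), Lemma 6.12 (PDF p. 42), Def. 3.9, Lemmas 4.6, 4.7.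
  [MilnorHCobordism1965]
* C. T. C. Wall, *Geometrical connectivity I*, J. London Math. Soc. (2) 3 (1971), 597–604,
  Thm. 3 (motivation; nothing of it is restated here).
* H. Whitney, *Differentiable manifolds*, Ann. of Math. 37 (1936), 645–680. [Whitney1936]
-/

open scoped Manifold ContDiff Topology
open Set Function Filter
open Literature.Geometry.Riemannian Literature.AlgebraicTopology.FundamentalGroup

noncomputable section

namespace Literature.Topology.FourManifolds

universe u

/-- Local notation: `𝔼 n` is the model Euclidean space `EuclideanSpace ℝ (Fin n)`. -/
local notation "𝔼 " n:arg => EuclideanSpace ℝ (Fin n)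

/-- Local notation: `𝕊 n` is the unit sphere in `EuclideanSpace ℝ (Fin (n + 1))`. -/
local notation "𝕊 " n:arg => (Metric.sphere (0 : EuclideanSpace ℝ (Fin (n + 1))) 1)

/-! ### A cast helper -/

section Cast

variable {Y : Type*} [TopologicalSpace Y]

/-- A loop is null-homotopic if a cast of it to another spelling of its base point is.
[folklore] -/
theorem Path.Homotopic.refl_of_cast {x x' : Y} {p : Path x x} (hx : x' = x)
    (h : (p.cast hx hx).Homotopic (Path.refl x')) : p.Homotopic (Path.refl x) := by
  subst hx
  exact h

end Cast

/-! ### Lemma 8.3 with class control -/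

section Lemma83

variable {n : ℕ} {M N : Type u} [TopologicalSpace M] [T2Space M] [SecondCountableTopology M]
  [ChartedSpace (𝔼 n) M] [IsManifold (𝓡 n) ∞ M] [CompactSpace M]
  [TopologicalSpace N] [T2Space N] [SecondCountableTopology N] [ChartedSpace (𝔼 n) N]
  [IsManifold (𝓡 n) ∞ N] [CompactSpace N]

open Cobordism FourManifolds.Flow in
/-- **Milnor 1965, Lemma 8.3 under `π₁(W, V) = 0`, with the circle null-homotopic in `W`.**
For a cobordism `c` of dimension `n + 1 ≥ 5`, a nice Morse function `g` without critical
points of index `0`, a smooth gradient-like `ξ`, a critical point `p` of index `1`,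
`π₁(W, inl M) = 0` (compression form), and the level `V₁₊` presented by `ι₁ : V₁ → W`: there
are a smoothly embedded circle `e : S¹ → V₁` and `x₀` with `S_R(p) ∩ ι₁(e(S¹)) = {x₀}`,
transversely in the level, `ι₁(e(S¹))` disjoint from the other right-hand spheres of index
`1`, **and the loop of `ι₁ ∘ e` null-homotopic rel base point in `W`** (the joining path of
the printed proof taken in the class of the reversed arc, by `π₁(W, T) = 0`,
`Cobordism.relPiOneTrivial_compl_rightHandSpheres`; the arc closed by
`exists_embedding_circle_through_arc_homotopic`).
[cite: MilnorHCobordism1965, Lemma 8.3 and its proof (PDF pp. 55–56), Lemma 6.12 (PDF p. 42)] [cite: Whitney1936] -/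
theorem Cobordism.exists_circle_transverse_rightHandSphere_null (hn : 4 ≤ n)
    {c : Cobordism n M N} {g : c.W → ℝ} (hg : c.IsNiceMorseFunction g)
    (hg0 : criticalSetOfIndex (𝓡∂ (n + 1)) g 0 = ∅)
    (ξ : Cₛ^∞⟮𝓡∂ (n + 1); 𝔼 (n + 1), (TangentSpace (𝓡∂ (n + 1)) : c.W → Type)⟯)
    (hξ : IsGradientLike (𝓡∂ (n + 1)) g ξ) {p : c.W}
    (hp : p ∈ criticalSetOfIndex (𝓡∂ (n + 1)) g 1) (hrel : RelPiOneTrivial c.W (range c.inl))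
    (V₁ : Type u) [TopologicalSpace V₁] [T2Space V₁] [SecondCountableTopology V₁]
    [CompactSpace V₁] [ChartedSpace (𝔼 n) V₁] [IsManifold (𝓡 n) ∞ V₁] (ι₁ : V₁ → c.W)
    (hι₁ : Manifold.IsSmoothEmbedding (𝓡 n) (𝓡∂ (n + 1)) ∞ ι₁)
    (hr₁ : range ι₁ = g ⁻¹' {Cobordism.plusLevel n 1}) :
    ∃ e : C(𝕊 1, V₁), Manifold.IsSmoothEmbedding (𝓡 1) (𝓡 n) ∞ e ∧ ∃ x₀ : c.W,
      rightHandSphere (𝓡∂ (n + 1)) g ξ p (Cobordism.plusLevel n 1) ∩ (ι₁ '' range e) = {x₀} ∧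
      IsTransverseInLevel (𝓡∂ (n + 1)) (g ⁻¹' {Cobordism.plusLevel n 1})
        (rightHandSphere (𝓡∂ (n + 1)) g ξ p (Cobordism.plusLevel n 1)) (ι₁ '' range e) x₀ ∧
      (∀ p' ∈ criticalSetOfIndex (𝓡∂ (n + 1)) g 1, p' ≠ p →
        Disjoint (rightHandSphere (𝓡∂ (n + 1)) g ξ p' (Cobordism.plusLevel n 1)) (ι₁ '' range e)) ∧
      (e.circleLoop.map hι₁.contMDiff.continuous).Homotopic (Path.refl _) := by
  classical
  -- levels
  set a₀ : ℝ := plusLevel n 1 with ha₀def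
  have h11 : niceLevel n 1 < a₀ := niceLevel_lt_plusLevel n 1
  have h12 : a₀ < niceLevel n 2 := plusLevel_lt_niceLevel_succ n 1
  have ha₀1 : a₀ < 1 := h12.trans (niceLevel_lt_one (by omega))
  have hLmono : StrictMono (niceLevel n) := niceLevel_strictMono n
  have hval : ∀ z ∈ criticalSet (𝓡∂ (n + 1)) g, g z = niceLevel n (morseIndex (𝓡∂ (n + 1)) g z) :=
    fun z hz => hg.2 z hz
  set C₁ : Set c.W := criticalSetOfIndex (𝓡∂ (n + 1)) g 1 with hC₁def
  have hC₁val : ∀ p' ∈ C₁, g p' = niceLevel n 1 := fun p' hp' => by rw [hval p' hp'.1, hp'.2]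
  have hC₁fin : C₁.Finite := (IsMorse.finite_criticalSet_holds hg.1.isMorse).subset fun w hw => hw.1
  -- no critical value in `(g p', a₀]` for `p' ∈ C₁`
  have hfree : ∀ p' ∈ C₁, ∀ z ∈ criticalSet (𝓡∂ (n + 1)) g, g z ∉ Ioc (g p') a₀ := by
    intro p' hp' z hz hzI
    rw [hC₁val p' hp', hval z hz] at hzI
    rcases le_or_gt (morseIndex (𝓡∂ (n + 1)) g z) 1 with hk | hk
    · exact absurd hzI.1 (not_lt.2 (hLmono.monotone hk))
    · exact absurd hzI.2 (not_le.2 (h12.trans_le (hLmono.monotone hk)))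
  have hlt : ∀ p' ∈ C₁, g p' < a₀ := fun p' hp' => by rw [hC₁val p' hp']; exact h11
  -- the smoothness data
  have hξs : ContMDiff (𝓡∂ (n + 1)) (𝓡∂ (n + 1)).tangent 1
      (fun w ↦ (⟨w, ξ w⟩ : TangentBundle (𝓡∂ (n + 1)) c.W)) :=
    ξ.contMDiff.of_le (WithTop.coe_le_coe.mpr le_top)
  ----------------------------------------------------------------------------------------------
  -- F1: the right-hand spheres of index `1` in `V₁₊` are compact; the chart about `x₀ ∈ S_R(p)`
  ----------------------------------------------------------------------------------------------
  have hcpt : ∀ p' ∈ C₁, IsCompact (rightHandSphere (𝓡∂ (n + 1)) g ξ p' a₀) := fun p' hp' =>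
    (Milnor1965_rightHandSphere_hypersurface_holds (by omega) hg.1 ξ hξ hp' (hlt p' hp') ha₀1 (hfree p' hp')).1
  obtain ⟨-, ⟨x₀, hx₀⟩, hchart⟩ := Milnor1965_rightHandSphere_hypersurface_holds (by omega) hg.1 ξ hξ hp (hlt p hp) ha₀1 (hfree p hp)
  obtain ⟨φ, hφ, hx₀φ, hint, ℓ, j, hℓj, hlev, hsph⟩ := hchart x₀ hx₀
  set Φ : PartialEquiv c.W (𝔼 (n + 1)) := φ.extend (𝓡∂ (n + 1)) with hΦdef
  set c₀ : 𝔼 (n + 1) := Φ x₀ with hc₀def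
  set v : 𝔼 (n + 1) := EuclideanSpace.single j (1 : ℝ) with hvdef
  have hv_apply : ∀ i, v i = if i = j then 1 else 0 := fun i => by
    simp [hvdef]
  have hvj : v j = 1 := by rw [hv_apply, if_pos rfl]
  have hvℓ : v ℓ = 0 := by rw [hv_apply, if_neg hℓj]
  have hx₀Φ : x₀ ∈ Φ.source := by rw [hΦdef, OpenPartialHomeomorph.extend_source]; exact hx₀φ
  have hgx₀ : g x₀ = a₀ := hx₀.2
  -- a ball of the extended chart about `c₀`
  obtain ⟨r, hr, hball⟩ : ∃ r > 0, Metric.ball c₀ r ⊆ Φ.target := by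
    have hopen : IsOpen ((𝓡∂ (n + 1)).symm ⁻¹' φ.target ∩ interior (range (𝓡∂ (n + 1)))) :=
      (φ.open_target.preimage (𝓡∂ (n + 1)).continuous_symm).inter isOpen_interior
    have hmem : c₀ ∈ (𝓡∂ (n + 1)).symm ⁻¹' φ.target ∩ interior (range (𝓡∂ (n + 1))) := by
      refine ⟨?_, hint x₀ hx₀φ⟩
      show (𝓡∂ (n + 1)).symm (φ.extend (𝓡∂ (n + 1)) x₀) ∈ φ.target
      rw [OpenPartialHomeomorph.extend_coe, comp_apply, ModelWithCorners.left_inv]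
      exact φ.map_source hx₀φ
    obtain ⟨r, hr, hsub⟩ := Metric.isOpen_iff.1 hopen c₀ hmem
    refine ⟨r, hr, fun y hy => ?_⟩
    rw [hΦdef, OpenPartialHomeomorph.extend_target]
    exact ⟨(hsub hy).1, interior_subset (hsub hy).2⟩
  -- the coordinate line `L t = Φ⁻¹ (c₀ + t v)`
  set L : ℝ → c.W := fun t => Φ.symm (c₀ + t • v) with hLdef
  have hLt : ∀ {t : ℝ}, |t| < r → c₀ + t • v ∈ Φ.target := fun {t} ht => by
    apply hball
    rw [Metric.mem_ball, dist_eq_norm, add_sub_cancel_left, norm_smul, Real.norm_eq_abs]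
    have : ‖v‖ = 1 := by simp [hvdef]
    rw [this, mul_one]
    exact ht
  have hLsrc : ∀ {t : ℝ}, |t| < r → L t ∈ φ.source := fun {t} ht => by
    have := Φ.map_target (hLt ht)
    rwa [hΦdef, OpenPartialHomeomorph.extend_source] at this
  have hΦL : ∀ {t : ℝ}, |t| < r → Φ (L t) = c₀ + t • v := fun {t} ht => Φ.right_inv (hLt ht)
  have hL0 : L 0 = x₀ := by
    show Φ.symm (c₀ + (0 : ℝ) • v) = x₀
    rw [zero_smul, add_zero]
    exact Φ.left_inv hx₀Φ
  have hΦLℓ : ∀ {t : ℝ}, |t| < r → Φ (L t) ℓ = c₀ ℓ := fun {t} ht => by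
    rw [hΦL ht, PiLp.add_apply, PiLp.smul_apply, hvℓ, smul_zero, add_zero]
  have hΦLj : ∀ {t : ℝ}, |t| < r → Φ (L t) j = c₀ j + t := fun {t} ht => by
    rw [hΦL ht, PiLp.add_apply, PiLp.smul_apply, hvj, smul_eq_mul, mul_one]
  have hgL : ∀ {t : ℝ}, |t| < r → g (L t) = a₀ := fun {t} ht =>
    (hlev (L t) (hLsrc ht)).2 (hΦLℓ ht)
  have hLsph : ∀ {t : ℝ}, |t| < r → (L t ∈ rightHandSphere (𝓡∂ (n + 1)) g ξ p a₀ ↔ t = 0) := by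
    intro t ht
    rw [hsph (L t) (hLsrc ht), hΦLℓ ht, hΦLj ht]
    constructor
    · rintro ⟨-, h⟩; linarith
    · intro h; subst h; exact ⟨rfl, by rw [add_zero]⟩
  -- `L` is continuous on `(-r, r)`
  have hLcont : ContinuousOn L (Ioo (-r) r) := by
    have h1 : ContinuousOn Φ.symm Φ.target := by
      rw [hΦdef]
      rw [OpenPartialHomeomorph.extend_target']
      exact (contMDiffOn_extend_symm hφ).continuousOn
    refine h1.comp (Continuous.continuousOn (by fun_prop)) fun t ht => hLt ?_
    exact abs_lt.2 ht
  ----------------------------------------------------------------------------------------------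
  -- shorten the arc off the other right-hand spheres
  ----------------------------------------------------------------------------------------------
  set K : Set c.W := ⋃ p' ∈ C₁ \ {p}, rightHandSphere (𝓡∂ (n + 1)) g ξ p' a₀ with hKdef
  have hKc : IsCompact K := (hC₁fin.subset Set.sdiff_subset).isCompact_biUnion fun p' hp' => hcpt p' hp'.1
  have hx₀K : x₀ ∉ K := by
    intro h
    rw [hKdef, mem_iUnion₂] at h
    obtain ⟨p', hp', hx⟩ := h
    exact hp'.2 (eq_of_mem_unstableSet_inter_unstableSet hξs ⟨hx.1, hx₀.1⟩)
  obtain ⟨r₁, hr₁pos, hr₁r, hLK⟩ : ∃ r₁ > 0, r₁ ≤ r ∧ ∀ t, |t| < r₁ → L t ∉ K := by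
    have h0 : (0 : ℝ) ∈ Ioo (-r) r := ⟨by linarith, hr⟩
    have hc : ContinuousAt L 0 := hLcont.continuousAt (Ioo_mem_nhds h0.1 h0.2)
    have hmem : L ⁻¹' Kᶜ ∈ 𝓝 (0 : ℝ) := hc.preimage_mem_nhds (hKc.isClosed.isOpen_compl.mem_nhds
      (by rw [hL0]; exact hx₀K))
    obtain ⟨ε, hε, hεsub⟩ := Metric.mem_nhds_iff.1 hmem
    refine ⟨min ε r, lt_min hε hr, min_le_right _ _, fun t ht => ?_⟩
    exact hεsub (by rw [Metric.mem_ball, dist_zero_right, Real.norm_eq_abs]; exact ht.trans_le (min_le_left _ _))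
  have hLout : ∀ {t : ℝ}, |t| < r₁ → t ≠ 0 → ∀ p' ∈ C₁, L t ∉ rightHandSphere (𝓡∂ (n + 1)) g ξ p' a₀ := by
    intro t ht ht0 p' hp' hmem
    by_cases hpp : p' = p
    · subst hpp
      exact ht0 ((hLsph (ht.trans_le hr₁r)).1 hmem)
    · exact hLK t ht (by rw [hKdef, mem_iUnion₂]; exact ⟨p', ⟨hp', hpp⟩, hmem⟩)
  ----------------------------------------------------------------------------------------------
  -- F2: the complement `O ⊆ V₁` of the right-hand spheres is open and path connected
  ----------------------------------------------------------------------------------------------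
  set T : Set c.W := {x | g x = a₀ ∧ ∀ p' ∈ C₁, x ∉ rightHandSphere (𝓡∂ (n + 1)) g ξ p' a₀} with hTdef
  set O : Set V₁ := ι₁ ⁻¹' T with hOdef
  have hι₁inj : Injective ι₁ := hι₁.isEmbedding.injective
  have hlevS : ∀ w : V₁, g (ι₁ w) = a₀ := fun w => by
    have : ι₁ w ∈ range ι₁ := mem_range_self w
    rw [hr₁] at this
    exact this
  have hOmem : ∀ w : V₁, w ∈ O ↔ ∀ p' ∈ C₁, ι₁ w ∉ rightHandSphere (𝓡∂ (n + 1)) g ξ p' a₀ :=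
    fun w => ⟨fun h => h.2, fun h => ⟨hlevS w, h⟩⟩
  have hOopen : IsOpen O := by
    have : O = (⋃ p' ∈ C₁, ι₁ ⁻¹' rightHandSphere (𝓡∂ (n + 1)) g ξ p' a₀)ᶜ := by
      ext w; rw [hOmem, mem_compl_iff, mem_iUnion₂]; push Not; rfl
    rw [this, isOpen_compl_iff]
    exact (hC₁fin.isClosed_biUnion fun p' hp' =>
      ((hcpt p' hp').isClosed.preimage hι₁.contMDiff.continuous))
  ----------------------------------------------------------------------------------------------
  -- the arc `γ : ℝ → V₁`, `ι₁ (γ t) = L (κ arctan t)`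
  ----------------------------------------------------------------------------------------------
  haveI : Nonempty V₁ := by
    have : x₀ ∈ range ι₁ := by rw [hr₁]; exact hgx₀
    obtain ⟨w, -⟩ := this
    exact ⟨w⟩
  set κ : ℝ := r₁ / Real.pi with hκdef
  have hκ : 0 < κ := div_pos hr₁pos Real.pi_pos
  set ς : ℝ → ℝ := fun t => κ * Real.arctan t with hςdef
  have hςlt : ∀ t, |ς t| < r₁ := fun t => by
    have h1 := Real.arctan_mem_Ioo t
    rw [hςdef]
    show |κ * Real.arctan t| < r₁
    rw [abs_mul, abs_of_pos hκ]
    have h2 : |Real.arctan t| < Real.pi / 2 := abs_lt.2 ⟨h1.1, h1.2⟩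
    calc κ * |Real.arctan t| < κ * (Real.pi / 2) := mul_lt_mul_of_pos_left h2 hκ
      _ = r₁ / 2 := by rw [hκdef]; field_simp
      _ < r₁ := by linarith
  have hςltr : ∀ t, |ς t| < r := fun t => (hςlt t).trans_le hr₁r
  have hς0 : ς 0 = 0 := by simp [hςdef]
  have hςne : ∀ t ≠ 0, ς t ≠ 0 := fun t ht h => ht (by
    have := mul_eq_zero.1 h
    rcases this with h1 | h1
    · exact absurd h1 hκ.ne'
    · exact Real.arctan_eq_zero_iff.1 h1)
  have hςinj : Injective ς := fun t t' h =>
    Real.arctan_injective (mul_left_cancel₀ hκ.ne' h)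
  have hςsmooth : ContDiff ℝ ∞ ς := contDiff_const.mul Real.contDiff_arctan
  have hςderiv : ∀ t, HasDerivAt ς (κ * (1 / (1 + t ^ 2))) t := fun t =>
    (Real.hasDerivAt_arctan t).const_mul κ
  -- the line in the chart, as a smooth map into the model space
  set A : ℝ → 𝔼 (n + 1) := fun t => c₀ + ς t • v with hAdef
  have hAsmooth : ContMDiff 𝓘(ℝ, ℝ) 𝓘(ℝ, 𝔼 (n + 1)) ∞ A :=
    (contDiff_const.add (hςsmooth.smul contDiff_const)).contMDiff
  have hAmem : ∀ t, A t ∈ Φ.target := fun t => hLt (hςltr t)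
  have hLς : ContMDiff 𝓘(ℝ, ℝ) (𝓡∂ (n + 1)) ∞ fun t => L (ς t) := by
    have h1 : ContMDiffOn 𝓘(ℝ, 𝔼 (n + 1)) (𝓡∂ (n + 1)) ∞ Φ.symm Φ.target := by
      rw [hΦdef, OpenPartialHomeomorph.extend_target']
      exact contMDiffOn_extend_symm hφ
    exact h1.comp_contMDiff hAsmooth hAmem
  have hLςlev : ∀ t, L (ς t) ∈ range ι₁ := fun t => by rw [hr₁]; exact hgL (hςltr t)
  set γ : ℝ → V₁ := fun t => invFun ι₁ (L (ς t)) with hγdef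
  have hιγ : ∀ t, ι₁ (γ t) = L (ς t) := fun t => invFun_eq (hLςlev t)
  have hιγ' : ι₁ ∘ γ = fun t => L (ς t) := funext hιγ
  have hγsmooth : ContMDiff 𝓘(ℝ, ℝ) (𝓡 n) ∞ γ :=
    contMDiff_of_comp_isSmoothEmbedding hι₁ (by rw [hιγ']; exact hLς)
  have hγ0 : ι₁ (γ 0) = x₀ := by rw [hιγ, hς0, hL0]
  have hγinj : Injective γ := by
    intro t t' h
    have h1 : L (ς t) = L (ς t') := by rw [← hιγ, ← hιγ, h]
    have h2 : Φ (L (ς t)) = Φ (L (ς t')) := by rw [h1]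
    rw [hΦL (hςltr t), hΦL (hςltr t'), add_right_inj] at h2
    have h3 := congrArg (fun w : 𝔼 (n + 1) => w j) h2
    simp only [PiLp.smul_apply, hvj, smul_eq_mul, mul_one] at h3
    exact hςinj h3
  -- the immersion property: `t ↦ (Φ (ι₁ (γ t))) j = c₀ j + ς t` has non-vanishing derivative
  have hγimm : ∀ t, Injective (mfderiv 𝓘(ℝ, ℝ) (𝓡 n) γ t) := by
    intro t
    -- the smooth left "coordinate" `lam y = (Φ (ι₁ y)) j` near `γ t`
    set lam : V₁ → ℝ := fun y => Φ (ι₁ y) j with hlamdef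
    have hproj : ContMDiff 𝓘(ℝ, 𝔼 (n + 1)) 𝓘(ℝ, ℝ) ∞ fun w : 𝔼 (n + 1) => w j := by
      have h := (EuclideanSpace.proj (𝕜 := ℝ) j : 𝔼 (n + 1) →L[ℝ] ℝ).contDiff.contMDiff (n := ∞)
      rwa [EuclideanSpace.coe_proj] at h
    have hΦat : ContMDiffAt (𝓡∂ (n + 1)) 𝓘(ℝ, 𝔼 (n + 1)) ∞ Φ (ι₁ (γ t)) := by
      rw [hΦdef]
      exact φ.contMDiffAt_extend hφ (by rw [hιγ]; exact hLsrc (hςltr t))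
    have hlam : ContMDiffAt (𝓡 n) 𝓘(ℝ, ℝ) ∞ lam (γ t) :=
      hproj.contMDiffAt.comp (γ t) (hΦat.comp (γ t) hι₁.contMDiff.contMDiffAt)
    have hcomp : lam ∘ γ = fun s => c₀ j + ς s := by
      funext s
      show Φ (ι₁ (γ s)) j = c₀ j + ς s
      rw [hιγ, hΦLj (hςltr s)]
    have hd : HasDerivAt (lam ∘ γ) (κ * (1 / (1 + t ^ 2))) t := by
      rw [hcomp]; exact (hςderiv t).const_add _
    have hne : κ * (1 / (1 + t ^ 2)) ≠ 0 := by positivity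
    have hmf : mfderiv 𝓘(ℝ, ℝ) 𝓘(ℝ, ℝ) (lam ∘ γ) t =
        (mfderiv (𝓡 n) 𝓘(ℝ, ℝ) lam (γ t)).comp (mfderiv 𝓘(ℝ, ℝ) (𝓡 n) γ t) :=
      mfderiv_comp t (hlam.mdifferentiableAt (by simp)) ((hγsmooth t).mdifferentiableAt (by simp))
    -- injectivity of the real derivative `fderiv ℝ (lam ∘ γ) t`, whose value at `1` is `≠ 0`
    have hT1 : fderiv ℝ (lam ∘ γ) t 1 = κ * (1 / (1 + t ^ 2)) :=
      fderiv_apply_one_eq_deriv.trans hd.deriv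
    have hinjf : Injective (fderiv ℝ (lam ∘ γ) t) := by
      have ha : ∀ b : ℝ, fderiv ℝ (lam ∘ γ) t b = b * (κ * (1 / (1 + t ^ 2))) := by
        intro b
        have h1 := (fderiv ℝ (lam ∘ γ) t).map_smul b (1 : ℝ)
        rw [smul_eq_mul, mul_one] at h1
        rw [h1, hT1, smul_eq_mul]
      intro a a' h
      rw [ha, ha] at h
      exact mul_right_cancel₀ hne h
    have hinj : Injective ⇑((mfderiv (𝓡 n) 𝓘(ℝ, ℝ) lam (γ t)).comp (mfderiv 𝓘(ℝ, ℝ) (𝓡 n) γ t)) := by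
      rw [← hmf, mfderiv_eq_fderiv]
      exact hinjf
    rw [ContinuousLinearMap.coe_comp] at hinj
    exact hinj.of_comp
  have hγO : ∀ t ≠ 0, γ t ∈ O := by
    intro t ht
    rw [hOmem]
    intro p' hp'
    rw [hιγ]
    exact hLout (hςlt t) (hςne t ht) p' hp'
  ----------------------------------------------------------------------------------------------
  -- the joining path: compress the reversed arc into `T`, keeping its class (`π₁(W, V) = 0`)
  ----------------------------------------------------------------------------------------------
  have hγcont : Continuous γ := hγsmooth.continuous
  have hι₁c : Continuous ι₁ := hι₁.contMDiff.continuous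
  have hTsub : T ⊆ range ι₁ := fun x hx => by rw [hr₁]; exact hx.1
  have hγT : ∀ t ≠ 0, ι₁ (γ t) ∈ T := fun t ht => hγO t ht
  set Ap : Path (γ 0) (γ 1) :=
    { toFun := fun t => γ t
      continuous_toFun := hγcont.comp continuous_subtype_val
      source' := rfl
      target' := rfl } with hApdef
  set Am : Path (γ (-1)) (γ 0) :=
    { toFun := fun t => γ ((t : ℝ) - 1)
      continuous_toFun := hγcont.comp (continuous_subtype_val.sub continuous_const)
      source' := by simp
      target' := by simp } with hAmdef
  set β : Path (ι₁ (γ 1)) (ι₁ (γ (-1))) := ((Am.trans Ap).map hι₁c).symm with hβdef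
  have hrelT : Literature.Geometry.Riemannian.RelPiOneTrivial c.W T :=
    Cobordism.relPiOneTrivial_compl_rightHandSpheres (by omega) hg hg0 ξ hξ hrel
  obtain ⟨ρ, hρT, hβρ⟩ := hrelT (hγT 1 one_ne_zero) (hγT (-1) (by norm_num)) β
  obtain ⟨pth, hpthρ, hpthT⟩ := hι₁.isEmbedding.exists_path_eq_map_of_subset hTsub ρ
    fun t => hρT ⟨t, rfl⟩
  have hγ0O : γ 0 ∉ O := by
    rw [hOmem]
    intro h
    exact h p hp (by rw [hγ0]; exact hx₀)
  have hpth : ∀ t, pth t ∈ O ∧ pth t ≠ γ 0 := fun t =>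
    ⟨hpthT t, fun h => hγ0O (h ▸ hpthT t)⟩
  ----------------------------------------------------------------------------------------------
  -- close the arc up to an embedded circle through `pth`, keeping the class
  ----------------------------------------------------------------------------------------------
  obtain ⟨e, he, he0, heO, ⟨U, hU, hUeq⟩, h0, hloop⟩ :=
    exists_embedding_circle_through_arc_homotopic (by omega) hOopen γ hγsmooth hγinj hγimm hγO
      pth hpth Ap (fun t => rfl) Am (fun t => rfl)
  set s₀ : 𝕊 1 := circlePoint 0 with hs₀def
  have hes₀ : e s₀ = γ 0 := he0
  -- the loop of `ι₁ ∘ e` is null-homotopic in `W`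
  have hnull : (e.circleLoop.map hι₁c).Homotopic (Path.refl _) := by
    -- the class of the model loop `Ap · pth · Am` in `W` is trivial
    have hq : Path.Homotopic.Quotient.mk (((Ap.trans pth).trans Am).map hι₁c) =
        Path.Homotopic.Quotient.refl (ι₁ (γ 0)) := by
      have hρβ : Path.Homotopic.Quotient.mk (pth.map hι₁c) =
          ((Path.Homotopic.Quotient.mk (Ap.map hι₁c)).symm).trans
            (Path.Homotopic.Quotient.mk (Am.map hι₁c)).symm := by
        rw [hpthρ, ← Path.Homotopic.Quotient.eq.2 hβρ, hβdef, Path.Homotopic.Quotient.mk_symm,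
          Path.map_trans, Path.Homotopic.Quotient.mk_trans, IsotopyTrack.quotient_symm_trans]
      rw [Path.map_trans, Path.map_trans, Path.Homotopic.Quotient.mk_trans,
        Path.Homotopic.Quotient.mk_trans, hρβ]
      simp only [Path.Homotopic.Quotient.symm_trans, IsotopyTrack.quotient_trans_symm_trans]
    have h2 : Path.Homotopic.Quotient.mk ((e.circleLoop.cast h0 h0).map hι₁c) =
        Path.Homotopic.Quotient.mk (((Ap.trans pth).trans Am).map hι₁c) :=
      Path.Homotopic.Quotient.eq.2 (hloop.map ⟨ι₁, hι₁c⟩)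
    have h1 : ((e.circleLoop.cast h0 h0).map hι₁c).Homotopic (Path.refl (ι₁ (γ 0))) :=
      Path.Homotopic.Quotient.eq.1 (by rw [h2, hq, Path.Homotopic.Quotient.mk_refl])
    exact Path.Homotopic.refl_of_cast (congrArg ι₁ h0) h1
  have hex₀ : ι₁ (e s₀) = x₀ := by rw [hes₀, hγ0]
  set S : Set c.W := ι₁ '' range e with hSdef
  have hSout : ∀ s ≠ s₀, ∀ p' ∈ C₁, ι₁ (e s) ∉ rightHandSphere (𝓡∂ (n + 1)) g ξ p' a₀ :=
    fun s hs => (hOmem (e s)).1 (heO s hs)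
  refine ⟨e, he, x₀, ?_, ?_, ?_, hnull⟩
  · -- `S_R(p) ∩ S = {x₀}`
    ext y
    constructor
    · rintro ⟨hyR, w, ⟨s, rfl⟩, rfl⟩
      by_cases hs : s = s₀
      · subst hs; exact hex₀
      · exact absurd hyR (hSout s hs p hp)
    · intro hy
      rw [mem_singleton_iff] at hy
      subst hy
      exact ⟨hx₀, e s₀, ⟨s₀, rfl⟩, hex₀⟩
  · ----------------------------------------------------------------------------------------
    -- transversality inside `V₁₊`: cut the chart down to a neighbourhood where `S` is the arc
    ----------------------------------------------------------------------------------------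
    -- a neighbourhood `W₁` of `x₀` in `W` whose trace on `V₁` lies in `U`
    have hUcomap : U ∈ comap ι₁ (𝓝 x₀) := by
      rw [← hγ0, ← hι₁.isEmbedding.isInducing.nhds_eq_comap]; exact hU
    obtain ⟨W₁, hW₁, hW₁U⟩ := mem_comap.1 hUcomap
    -- the bound on the `j`-coordinate making points of the line points of the arc `γ[-1, 1]`
    set δ : ℝ := ς 1 with hδdef
    have hδ : 0 < δ := by rw [hδdef, hςdef]; exact mul_pos hκ (by
      rw [← Real.arctan_zero]; exact Real.arctan_strictMono zero_lt_one)
    have hςsurj : ∀ t', |t'| ≤ δ → ∃ t ∈ Icc (-1 : ℝ) 1, ς t = t' := by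
      intro t' ht'
      have hc : ContinuousOn ς (Icc (-1) 1) := hςsmooth.continuous.continuousOn
      have hm1 : ς (-1) = -δ := by rw [hδdef, hςdef]; simp [Real.arctan_neg]
      have hmem : t' ∈ Icc (ς (-1)) (ς 1) := by
        rw [hm1]; exact ⟨(abs_le.1 ht').1, (abs_le.1 ht').2⟩
      exact intermediate_value_Icc (by norm_num) hc hmem
    -- the open set where the `j`-coordinate is close to that of `x₀`
    set W₂ : Set c.W := φ.source ∩ Φ ⁻¹' {w | |w j - c₀ j| < δ} with hW₂def
    have hW₂o : IsOpen W₂ := by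
      have hc : ContinuousOn Φ φ.source := by
        rw [hΦdef]; exact (φ.contMDiffOn_extend hφ).continuousOn
      refine hc.isOpen_inter_preimage φ.open_source ?_
      have : Continuous fun w : 𝔼 (n + 1) => |w j - c₀ j| := by fun_prop
      exact isOpen_lt this continuous_const
    set W₀ : Set c.W := interior W₁ ∩ W₂ with hW₀def
    have hW₀o : IsOpen W₀ := isOpen_interior.inter hW₂o
    have hx₀W₀ : x₀ ∈ W₀ := by
      refine ⟨mem_interior_iff_mem_nhds.2 hW₁, hx₀φ, ?_⟩
      show |Φ x₀ j - c₀ j| < δ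
      rw [hc₀def, sub_self, abs_zero]; exact hδ
    -- on `φ.source ∩ W₀`, the circle is the coordinate line through `c₀` in the direction `j`
    have key : ∀ y ∈ φ.source ∩ W₀, (y ∈ S ↔ ∀ i, i ≠ j → Φ y i = c₀ i) := by
      rintro y ⟨hyφ, hyW₁, -, hyj⟩
      have hyj' : |Φ y j - c₀ j| < δ := hyj
      have hyΦ : y ∈ Φ.source := by rw [hΦdef, OpenPartialHomeomorph.extend_source]; exact hyφ
      constructor
      · -- a point of the circle in `W₀` is a point of the arc
        rintro ⟨w, ⟨s, rfl⟩, rfl⟩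
        have hsU : e s ∈ U := hW₁U (show ι₁ (e s) ∈ W₁ from interior_subset hyW₁)
        have : e s ∈ range e ∩ U := ⟨⟨s, rfl⟩, hsU⟩
        rw [hUeq] at this
        obtain ⟨⟨t, -, hts⟩, -⟩ := this
        intro i hi
        rw [← hts, hιγ, hΦL (hςltr t), PiLp.add_apply, PiLp.smul_apply, hv_apply, if_neg hi,
          smul_zero, add_zero]
      · -- a point of the line in `W₀` is `L t'` with `|t'| < δ`, hence a point of `γ[-1, 1] ∩ U`
        intro hline
        set t' : ℝ := Φ y j - c₀ j with ht'def
        have ht'r : |t'| < r := hyj'.trans_le ((le_abs_self _).trans ((hςlt 1).le.trans hr₁r))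
        have hyeq : Φ y = c₀ + t' • v := by
          ext i
          rw [PiLp.add_apply, PiLp.smul_apply, hv_apply]
          by_cases hi : i = j
          · subst hi; simp [ht'def]
          · rw [if_neg hi, smul_zero, add_zero]; exact hline i hi
        have hyL : y = L t' := by
          show y = Φ.symm (c₀ + t' • v)
          rw [← hyeq, Φ.left_inv hyΦ]
        obtain ⟨t, ht, htt'⟩ := hςsurj t' hyj'.le
        have hyγ : y = ι₁ (γ t) := by rw [hιγ, htt', ← hyL]
        have htU : γ t ∈ U := hW₁U (show ι₁ (γ t) ∈ W₁ by rw [← hyγ]; exact interior_subset hyW₁)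
        have : γ t ∈ γ '' Icc (-1) 1 ∩ U := ⟨⟨t, ht, rfl⟩, htU⟩
        rw [← hUeq] at this
        obtain ⟨⟨s, hs⟩, -⟩ := this
        exact ⟨e s, ⟨s, rfl⟩, by rw [hyγ, hs]⟩
    -- the cut-down chart
    refine ⟨φ.restr W₀, restr_mem_maximalAtlas (contDiffGroupoid ∞ (𝓡∂ (n + 1))) hφ hW₀o, ?_,
      ℓ, {i | i ≠ ℓ ∧ i ≠ j}, fun h => h.1 rfl, ?_, ?_, ?_⟩
    · rw [OpenPartialHomeomorph.restr_source, hW₀o.interior_eq]; exact ⟨hx₀φ, hx₀W₀⟩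
    · intro y hy
      rw [OpenPartialHomeomorph.restr_source, hW₀o.interior_eq] at hy
      exact hlev y hy.1
    · intro y hy
      rw [OpenPartialHomeomorph.restr_source, hW₀o.interior_eq] at hy
      rw [hsph y hy.1]
      show _ ↔ ∀ i, i ∉ {i | i ≠ ℓ ∧ i ≠ j} → Φ y i = c₀ i
      constructor
      · rintro ⟨h1, h2⟩ i hi
        simp only [mem_setOf_eq, not_and_or, not_not] at hi
        rcases hi with rfl | rfl
        · exact h1
        · exact h2
      · intro h
        exact ⟨h ℓ (by simp), h j (by simp)⟩
    · intro y hy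
      rw [OpenPartialHomeomorph.restr_source, hW₀o.interior_eq] at hy
      rw [key y hy]
      show _ ↔ ∀ i, i = ℓ ∨ i ∈ {i | i ≠ ℓ ∧ i ≠ j} → Φ y i = c₀ i
      constructor
      · intro h i hi
        rcases hi with rfl | hi
        · exact h _ hℓj
        · exact h i hi.2
      · intro h i hi
        by_cases hil : i = ℓ
        · exact h i (Or.inl hil)
        · exact h i (Or.inr ⟨hil, hi⟩)
  · -- no other right-hand sphere is met
    intro p' hp' hpp
    refine Set.disjoint_left.2 fun y hyR hyS => ?_
    obtain ⟨w, ⟨s, rfl⟩, rfl⟩ := hyS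
    by_cases hs : s = s₀
    · subst hs
      rw [hex₀] at hyR
      exact hpp (eq_of_mem_unstableSet_inter_unstableSet hξs ⟨hyR.1, hx₀.1⟩)
    · exact hSout s hs p' hp' hyR


end Lemma83

/-! ### The ideal circle and its translate, null-homotopic in `W` -/

section IdealCircle

variable {n : ℕ} {M N : Type u} [TopologicalSpace M] [T2Space M] [SecondCountableTopology M]
  [ChartedSpace (𝔼 n) M] [IsManifold (𝓡 n) ∞ M] [CompactSpace M]
  [TopologicalSpace N] [T2Space N] [SecondCountableTopology N] [ChartedSpace (𝔼 n) N]
  [IsManifold (𝓡 n) ∞ N] [CompactSpace N]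

open Cobordism FourManifolds.Flow in
/-- **Milnor 1965, Lemma 8.3 with its two sequels (PDF pp. 55–56) under `π₁(W, V) = 0`, the
translated circle `S₁ ⊂ V₂₊` being null-homotopic in `W`.**  The statement of
`Cobordism.Milnor1965_exists_idealCircle` (adjusted field `ξ'`, embedded circle `e₁ : S¹ → V`
in the presentation `ι : V → W` of `V₂₊`, the ideal circle `S ⊂ V₁₊` as the set of points
translated into `S₁`, meeting `S_R(p)` in one point, transversely) with "`V` connected"
replaced by `π₁(W, inl M) = 0`, **plus**: the loop of `ι ∘ e₁` is null-homotopic rel base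
point in `W` (the translation along the trajectories of `ξ'` is a homotopy in `W`).
[cite: MilnorHCobordism1965, Lemma 8.3 and proof of Thm. 8.1 Index 1 (PDF pp. 55–56), with Lemmas 4.6, 4.7 (PDF pp. 23–25)] -/
theorem Cobordism.exists_idealCircle_null (hn : 4 ≤ n)
    {c : Cobordism n M N} {g : c.W → ℝ} (hg : c.IsNiceMorseFunction g)
    (hg0 : criticalSetOfIndex (𝓡∂ (n + 1)) g 0 = ∅)
    (ξ : Cₛ^∞⟮𝓡∂ (n + 1); 𝔼 (n + 1), (TangentSpace (𝓡∂ (n + 1)) : c.W → Type)⟯)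
    (hξ : IsGradientLike (𝓡∂ (n + 1)) g ξ) {p : c.W}
    (hp : p ∈ criticalSetOfIndex (𝓡∂ (n + 1)) g 1) (hrel : RelPiOneTrivial c.W (range c.inl))
    (V : Type u) [TopologicalSpace V] [T2Space V] [SecondCountableTopology V] [CompactSpace V]
    [ChartedSpace (𝔼 n) V] [IsManifold (𝓡 n) ∞ V] (ι : V → c.W)
    (hι : Manifold.IsSmoothEmbedding (𝓡 n) (𝓡∂ (n + 1)) ∞ ι)
    (hrange : range ι = g ⁻¹' {Cobordism.plusLevel n 2}) :
    ∃ ξ' : Cₛ^∞⟮𝓡∂ (n + 1); 𝔼 (n + 1), (TangentSpace (𝓡∂ (n + 1)) : c.W → Type)⟯,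
      IsGradientLike (𝓡∂ (n + 1)) g ξ' ∧
      ∃ e₁ : C(𝕊 1, V), Manifold.IsSmoothEmbedding (𝓡 1) (𝓡 n) ∞ e₁ ∧
        (e₁.circleLoop.map hι.contMDiff.continuous).Homotopic (Path.refl _) ∧ ∃ x₀ : c.W,
        (∀ y ∈ ι '' range e₁, ∃ x, g x = Cobordism.plusLevel n 1 ∧ FlowsTo (𝓡∂ (n + 1)) ξ' x y) ∧
        rightHandSphere (𝓡∂ (n + 1)) g ξ' p (Cobordism.plusLevel n 1) ∩
            {x | g x = Cobordism.plusLevel n 1 ∧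
              ∃ y ∈ ι '' range e₁, FlowsTo (𝓡∂ (n + 1)) ξ' x y} = {x₀} ∧
        IsTransverseInLevel (𝓡∂ (n + 1)) (g ⁻¹' {Cobordism.plusLevel n 1})
          (rightHandSphere (𝓡∂ (n + 1)) g ξ' p (Cobordism.plusLevel n 1))
          {x | g x = Cobordism.plusLevel n 1 ∧ ∃ y ∈ ι '' range e₁, FlowsTo (𝓡∂ (n + 1)) ξ' x y}
          x₀ := by
  -- the level `V₁₊` as a closed manifold `RegularLevel h1`, embedded by `incl`
  haveI : NeZero n := ⟨by omega⟩
  have h11 : niceLevel n 1 < plusLevel n 1 := niceLevel_lt_plusLevel n 1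
  have h12 : plusLevel n 1 < niceLevel n 2 := plusLevel_lt_niceLevel_succ n 1
  have hP1pos : 0 < plusLevel n 1 := (niceLevel_pos n 1).trans h11
  have hP1lt : plusLevel n 1 < 1 := h12.trans (niceLevel_lt_one (by omega))
  have hreg : ∀ w, g w = plusLevel n 1 → ¬ IsMCriticalPt (𝓡∂ (n + 1)) g w := fun w hw =>
    hg.not_isMCriticalPt_of_apply_eq_plusLevel hw
  have h1 : IsRegularLevel (𝓡∂ (n + 1)) g (plusLevel n 1) :=
    hg.1.isRegularLevel ⟨hP1pos, hP1lt⟩ fun z hz h => hreg z h hz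
  have hgd : MDifferentiable (𝓡∂ (n + 1)) 𝓘(ℝ, ℝ) g :=
    hg.1.isMorse.contMDiff.mdifferentiable (by simp)
  ----------------------------------------------------------------------------------------------
  -- Step 1 (Lemma 8.3): the circle `S ⊂ V₁₊` crossing `S_R(p)` once, transversely, in `x₀`.
  ----------------------------------------------------------------------------------------------
  obtain ⟨e, he, x₀, hx₀, htr, -, hnull⟩ :=
    Cobordism.exists_circle_transverse_rightHandSphere_null hn hg hg0 ξ hξ hp hrel
      (RegularLevel h1) (RegularLevel.incl h1)
      (RegularLevel.isSmoothEmbedding_incl h1) (RegularLevel.range_incl h1)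
  set S : Set c.W := RegularLevel.incl h1 '' range e with hSdef
  ----------------------------------------------------------------------------------------------
  -- Step 2 (4.6, 4.7): adjust `ξ` above `V₁₊` so that `S` meets no left-hand `1`-sphere.
  ----------------------------------------------------------------------------------------------
  obtain ⟨ξ', hξ', ⟨b, hb1, -, hξ'eq⟩, hdisj⟩ :=
    Cobordism.Milnor1965_adjust_field_avoid_leftHandSpheres_holds hn hg ξ hξ (RegularLevel h1)
      (RegularLevel.incl h1)
      (RegularLevel.isSmoothEmbedding_incl h1) (RegularLevel.range_incl h1) e he
  have heq_le : ∀ w, g w ≤ plusLevel n 1 → ξ' w = ξ w := fun w hw =>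
    hξ'eq w fun h => (not_lt.2 hw) h.1
  have hnn : ∀ w, 0 ≤ mlineDeriv (𝓡∂ (n + 1)) g w (ξ w) :=
    mlineDeriv_nonneg_of_pos_of_not_isMCriticalPt hξ.mlineDeriv_pos
  have hnn' : ∀ w, 0 ≤ mlineDeriv (𝓡∂ (n + 1)) g w (ξ' w) :=
    mlineDeriv_nonneg_of_pos_of_not_isMCriticalPt hξ'.mlineDeriv_pos
  -- the right-hand sphere of `p` in `V₁₊` is unchanged
  have hSR : rightHandSphere (𝓡∂ (n + 1)) g ξ' p (plusLevel n 1) =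
      rightHandSphere (𝓡∂ (n + 1)) g ξ p (plusLevel n 1) := by
    ext x
    simp only [mem_rightHandSphere_iff]
    constructor
    · rintro ⟨hx, hx1⟩
      exact ⟨mem_unstableSet_of_field_eq_of_apply_le hgd hnn' (a := plusLevel n 1)
        (fun w hw => (heq_le w hw).symm) hx hx1.le, hx1⟩
    · rintro ⟨hx, hx1⟩
      exact ⟨mem_unstableSet_of_field_eq_of_apply_le hgd hnn (a := plusLevel n 1)
        (fun w hw => heq_le w hw) hx hx1.le, hx1⟩
  ----------------------------------------------------------------------------------------------
  -- Step 3: translate `S` right along `ξ'` to the embedded circle `S₁ ⊂ V₂₊`.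
  ----------------------------------------------------------------------------------------------
  obtain ⟨e₁, he₁, hflow⟩ :=
    Cobordism.Milnor1965_translate_circle_right_holds hn hg ξ' hξ' (RegularLevel h1) (RegularLevel.incl h1)
      (RegularLevel.isSmoothEmbedding_incl h1) (RegularLevel.range_incl h1) V ι hι hrange e he
      hdisj
  -- the points of `V₁₊` translated into `S₁` form exactly `S`
  have hv' : ContMDiff (𝓡∂ (n + 1)) (𝓡∂ (n + 1)).tangent ∞
      (fun w ↦ (⟨w, ξ' w⟩ : TangentBundle (𝓡∂ (n + 1)) c.W)) := ξ'.contMDiff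
  have hS' : {x | g x = plusLevel n 1 ∧ ∃ y ∈ ι '' range e₁, FlowsTo (𝓡∂ (n + 1)) ξ' x y} = S := by
    ext x
    constructor
    · rintro ⟨hx, y, ⟨v, ⟨s, rfl⟩, rfl⟩, hxy⟩
      have hxs : x = RegularLevel.incl h1 (e s) :=
        FlowsTo.eq_of_flowsTo_of_apply_eq hv' hgd hξ'.mlineDeriv_pos hreg hxy (hflow s) hx
          (RegularLevel.apply_incl h1 _)
      exact ⟨e s, ⟨s, rfl⟩, hxs.symm⟩
    · rintro ⟨v, ⟨s, rfl⟩, rfl⟩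
      exact ⟨RegularLevel.apply_incl h1 _, ι (e₁ s), ⟨e₁ s, ⟨s, rfl⟩, rfl⟩, hflow s⟩
  ----------------------------------------------------------------------------------------------
  -- Step 3': the translation is a homotopy in `W`, so the loop of `ι ∘ e₁` is null-homotopic.
  ----------------------------------------------------------------------------------------------
  have hnull₁ : (e₁.circleLoop.map hι.contMDiff.continuous).Homotopic (Path.refl _) := by
    have hιc : Continuous ι := hι.contMDiff.continuous
    have hinclc : Continuous (RegularLevel.incl h1) := (RegularLevel.isSmoothEmbedding_incl h1).contMDiff.continuous
    -- levels of the slab `[V₁₊, V₂₊]`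
    have h22 : niceLevel n 2 < plusLevel n 2 := niceLevel_lt_plusLevel n 2
    have h23 : plusLevel n 2 < niceLevel n 3 := plusLevel_lt_niceLevel_succ n 2
    have hP12 : plusLevel n 1 < plusLevel n 2 := h12.trans h22
    have hP2lt : plusLevel n 2 < 1 := h23.trans (niceLevel_lt_one (by omega))
    have hreg₂ : ∀ w, g w = plusLevel n 2 → ¬ IsMCriticalPt (𝓡∂ (n + 1)) g w := fun w hw =>
      hg.not_isMCriticalPt_of_apply_eq_plusLevel hw
    have hLmono : StrictMono (niceLevel n) := niceLevel_strictMono n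
    have hval : ∀ z, IsMCriticalPt (𝓡∂ (n + 1)) g z →
        g z = niceLevel n (morseIndex (𝓡∂ (n + 1)) g z) := fun z hz => hg.2 z hz
    -- the slab flow of `ξ'`
    obtain ⟨θ, hθ⟩ := hg.1.exists_slabFlow ξ'.contMDiff hξ' hP1pos hP12 hP2lt
    have hP : PreSlabFlow c g ξ' (plusLevel n 1) (plusLevel n 2) θ := hθ.toPreSlabFlow
    have ha₁I : plusLevel n 2 ∈ Icc (plusLevel n 1) (plusLevel n 2) := ⟨hP12.le, le_rfl⟩
    have htr₂ : ∀ x, g x = plusLevel n 2 →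
        0 < mlineDeriv (𝓡∂ (n + 1)) g x (slabField g ξ' (plusLevel n 1) (plusLevel n 2) x) := by
      intro x hx
      rw [hP.slabField_eq (by rw [hx]; exact ha₁I)]
      exact hξ'.mlineDeriv_pos x (hreg₂ x hx)
    -- every point of `S` is carried up to `V₂₊`
    set τ : c.W → ℝ := hittingTime θ g (plusLevel n 2) with hτdef
    have hup : ∀ u, Hits θ g (plusLevel n 2) (RegularLevel.incl h1 (e u)) ∧
        FlowsTo (𝓡∂ (n + 1)) ξ' (RegularLevel.incl h1 (e u))
          (θ (τ (RegularLevel.incl h1 (e u)), RegularLevel.incl h1 (e u))) := by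
      intro u
      set x := RegularLevel.incl h1 (e u) with hxdef
      have hx : g x = plusLevel n 1 := RegularLevel.apply_incl h1 _
      have hK : ∀ q, IsMCriticalPt (𝓡∂ (n + 1)) g q → g q ∈ Icc (plusLevel n 1) (plusLevel n 2) →
          x ∉ stableSet (𝓡∂ (n + 1)) ξ' q := by
        intro q hq hgq hxq
        have hq2 : q ∈ criticalSetOfIndex (𝓡∂ (n + 1)) g 2 := by
          refine ⟨hq, ?_⟩
          have h1' : g q = niceLevel n (morseIndex (𝓡∂ (n + 1)) g q) := hval q hq
          rcases Nat.lt_or_ge (morseIndex (𝓡∂ (n + 1)) g q) 2 with hlt | hge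
          · have : niceLevel n (morseIndex (𝓡∂ (n + 1)) g q) ≤ niceLevel n 1 :=
              hLmono.monotone (by omega)
            rw [← h1'] at this
            linarith [hgq.1]
          · rcases Nat.eq_or_lt_of_le hge with heq | hlt
            · exact heq.symm
            · have : niceLevel n 3 ≤ niceLevel n (morseIndex (𝓡∂ (n + 1)) g q) :=
                hLmono.monotone (by omega)
              rw [← h1'] at this
              linarith [hgq.2]
        exact Set.disjoint_left.1 (hdisj q hq2) ⟨hxq, hx⟩ ⟨e u, ⟨u, rfl⟩, rfl⟩
      obtain ⟨t₁, ht₁, hgt₁, hslab⟩ :=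
        hP.exists_apply_eq_of_forall_not_mem_stableSet hP12.le hreg hx hK
      have hτ : τ x = t₁ := hP.isSmoothFlow.hittingTime_unique hgd htr₂ hgt₁
      refine ⟨⟨t₁, hgt₁⟩, ?_⟩
      rw [hτ]
      exact hP.flowsTo_apply ht₁ hslab
    -- the flow homotopy from `incl ∘ e` to `ι ∘ e₁`
    set f : C(𝕊 1, c.W) := (⟨RegularLevel.incl h1, hinclc⟩ : C(RegularLevel h1, c.W)).comp e with hfdef
    set g' : C(𝕊 1, c.W) := (⟨ι, hιc⟩ : C(V, c.W)).comp e₁ with hg'def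
    have hxI : ∀ u, g (RegularLevel.incl h1 (e u)) ∈ Icc (plusLevel n 1) (plusLevel n 2) := fun u => by
      rw [RegularLevel.apply_incl h1]; exact ⟨le_rfl, hP12.le⟩
    have hΦc : Continuous fun q : unitInterval × 𝕊 1 =>
        θ ((q.1 : ℝ) * τ (RegularLevel.incl h1 (e q.2)), RegularLevel.incl h1 (e q.2)) := by
      refine (hθ.continuousOn_flowToLevel ha₁I hreg₂).comp_continuous
        (continuous_fst.prodMk ((hinclc.comp e.continuous).comp continuous_snd)) fun q => ?_
      exact ⟨mem_univ _, hxI q.2, (hup q.2).1⟩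
    have hend : ∀ u, θ (τ (RegularLevel.incl h1 (e u)), RegularLevel.incl h1 (e u)) = ι (e₁ u) := by
      intro u
      refine FlowsTo.eq_of_apply_eq hv' hgd hξ'.mlineDeriv_pos (hup u).2 (hflow u) ?_ fun w hw => ?_
      · rw [apply_hittingTime (hup u).1]
        have : ι (e₁ u) ∈ range ι := ⟨_, rfl⟩
        rw [hrange] at this
        exact this.symm
      · rw [apply_hittingTime (hup u).1] at hw
        exact hreg₂ w hw
    let H : f.Homotopy g' :=
      { toFun := fun q => θ ((q.1 : ℝ) * τ (RegularLevel.incl h1 (e q.2)), RegularLevel.incl h1 (e q.2))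
        continuous_toFun := hΦc
        map_zero_left := fun u => by
          show θ (((0 : unitInterval) : ℝ) * τ (RegularLevel.incl h1 (e u)), RegularLevel.incl h1 (e u)) = f u
          rw [show ((0 : unitInterval) : ℝ) = 0 from rfl, zero_mul, hP.isSmoothFlow.map_zero]
          rfl
        map_one_left := fun u => by
          show θ (((1 : unitInterval) : ℝ) * τ (RegularLevel.incl h1 (e u)), RegularLevel.incl h1 (e u)) = g' u
          rw [show ((1 : unitInterval) : ℝ) = 1 from rfl, one_mul, hend u]
          rfl }
    have hnullf : f.circleLoop.Homotopic (Path.refl _) := by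
      rw [hfdef, ContinuousMap.circleLoop_comp]
      exact hnull
    have h := ContinuousMap.circleLoop_homotopic_refl_of_homotopy H hnullf
    rw [hg'def, ContinuousMap.circleLoop_comp] at h
    exact h
  ----------------------------------------------------------------------------------------------
  -- Conclusion.
  ----------------------------------------------------------------------------------------------
  refine ⟨ξ', hξ', e₁, he₁, hnull₁, x₀, ?_, ?_, ?_⟩
  · -- every point of `S₁` is reached from `V₁₊`
    rintro y ⟨v, ⟨s, rfl⟩, rfl⟩
    exact ⟨_, RegularLevel.apply_incl h1 (e s), hflow s⟩
  · -- `S_R(p) ∩ S = {x₀}`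
    rw [hSR, hS']
    exact hx₀
  · -- transversality inside `V₁₊`
    rw [hSR, hS']
    exact htr

end IdealCircle

end Literature.Topology.FourManifolds

end
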